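import Summits.Ventures.PercRepro.C025ProfilePLDResidual

/-!
# PER-LAYER DOMINANCE ON EVERY MATROID WHOSE CIRCUITS ARE LOOPS OR HAVE `≥ ρ(E)` POINTS (night-3 g28)

`proofs/NIGHT3-G28-PAVING.md` §2d.  The paving theorem `PavingPLD.pld_of_paving` extends verbatim to matroids whose only
small circuits are LOOPS (`∀ C, M.IsCircuit C → C.encard = 1 ∨ M.eRank ≤ C.encard`): loops never change a rank
(`eRk_nonloops`), a loopless set of rank `≤ ρ(E) − 2` or of fewer than `ρ(E)` points is independent
(`indep_of_loopless_eRk_add_two_le`, `indep_of_loopless_card_lt_rank`), and the natural image of a residual source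
`(I, D)` is still a high pair: the non-loop part `I₀` of `I` has `ρ(I)` points, `I₀ ∪ D` is independent with
`ρ(I) + δ` points, and the selected basis of `I ∪ D` is exactly `I₀ ∪ D ⊇ D` (`residual_facts_loops`).  The residual
reduction `pld_of_card_residual_le_all` does the rest (`pld_of_paving_loops`).  EVERY MATROID OF RANK `≤ 2` satisfies
the hypothesis (a circuit has `≥ 1` point), so (PLD) holds on every finite matroid of rank `≤ 2` (`pld_of_eRank_le_two`)
and C-025 at every `(p, q)` on every truncation of «rank `≤ 2` plus free points» (`rls_truncate_disjointSum_freeOn_of_eRank_le_two`).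
No `def`, no `instance`, no notation.  Axioms: standard.
-/

open scoped Matroid

namespace PercRepro

open Finset ThmH

namespace PavingPLD

variable {α : Type} [DecidableEq α]

omit [DecidableEq α] in
/-- A circuit of one point is a loop: its rank is `0`. -/
theorem eRk_eq_zero_of_isCircuit_encard_eq_one (M : Matroid α) [M.Finite] {C : Set α} (hC : M.IsCircuit C)
    (h1 : C.encard = 1) : M.eRk C = 0 := by
  have h := hC.eRk_add_one_eq
  rw [h1] at h
  obtain ⟨c, hc⟩ : ∃ c : ℕ, M.eRk C = c := ⟨_, (ENat.coe_toNat (eRk_ne_top M _)).symm⟩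
  rw [hc] at h ⊢
  have h' : c + 1 = 1 := by exact_mod_cast h
  have : c = 0 := by omega
  rw [this]; rfl

omit [DecidableEq α] in
/-- If every circuit is a loop or has `≥ ρ(E)` points, a LOOPLESS set of rank `≤ ρ(E) − 2` is independent. -/
theorem indep_of_loopless_eRk_add_two_le (M : Matroid α) [M.Finite]
    (hpav : ∀ C, M.IsCircuit C → C.encard = 1 ∨ M.eRank ≤ C.encard) (X : Set α) (hX : X ⊆ M.E)
    (hloop : ∀ e ∈ X, M.eRk {e} ≠ 0) (h : (M.eRk X).toNat + 2 ≤ M.eRank.toNat) : M.Indep X := by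
  by_contra hind
  obtain ⟨C, hCX, hC⟩ := ((M.not_indep_iff hX).1 hind).exists_isCircuit_subset
  rcases hpav C hC with h1 | h1
  · obtain ⟨e, rfl⟩ := Set.encard_eq_one.1 h1
    exact hloop e (hCX (Set.mem_singleton e)) (eRk_eq_zero_of_isCircuit_encard_eq_one M hC h1)
  · have h2 : M.eRank ≤ M.eRk C + 1 := by rw [hC.eRk_add_one_eq]; exact h1
    have h3 : M.eRk C ≤ M.eRk X := M.eRk_mono hCX
    obtain ⟨x, hx⟩ : ∃ x : ℕ, M.eRk X = x := ⟨_, (ENat.coe_toNat (eRk_ne_top M _)).symm⟩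
    obtain ⟨r, hr⟩ : ∃ r : ℕ, M.eRank = r :=
      ⟨_, (ENat.coe_toNat (M.eRank_ne_top_iff.2 inferInstance)).symm⟩
    rw [hx, ENat.toNat_coe, hr, ENat.toNat_coe] at h
    rw [hr] at h2
    rw [hx] at h3
    have h4 : (r : ℕ∞) ≤ (x : ℕ∞) + 1 := h2.trans (add_le_add h3 (le_refl 1))
    have h5 : r ≤ x + 1 := by exact_mod_cast h4
    omega

omit [DecidableEq α] in
/-- If every circuit is a loop or has `≥ ρ(E)` points, a LOOPLESS finset of fewer than `ρ(E)` points is independent. -/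
theorem indep_of_loopless_card_lt_rank (M : Matroid α) [M.Finite]
    (hpav : ∀ C, M.IsCircuit C → C.encard = 1 ∨ M.eRank ≤ C.encard) (T : Finset α) (hT : T ⊆ gr M)
    (hloop : ∀ e ∈ T, M.eRk {e} ≠ 0) (h : T.card < M.eRank.toNat) : M.Indep (T : Set α) := by
  by_contra hind
  have hTE : (T : Set α) ⊆ M.E := by rw [← coe_gr]; exact coe_subset.2 hT
  obtain ⟨C, hCT, hC⟩ := ((M.not_indep_iff hTE).1 hind).exists_isCircuit_subset
  rcases hpav C hC with h1 | h1
  · obtain ⟨e, rfl⟩ := Set.encard_eq_one.1 h1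
    exact hloop e (mem_coe.1 (hCT (Set.mem_singleton e))) (eRk_eq_zero_of_isCircuit_encard_eq_one M hC h1)
  · have h2 : M.eRank ≤ (T : Set α).encard := h1.trans (Set.encard_le_encard hCT)
    rw [Set.encard_coe_eq_coe_finsetCard] at h2
    obtain ⟨r, hr⟩ : ∃ r : ℕ, M.eRank = r :=
      ⟨_, (ENat.coe_toNat (M.eRank_ne_top_iff.2 inferInstance)).symm⟩
    rw [hr, ENat.toNat_coe] at h
    rw [hr] at h2
    have h3 : r ≤ T.card := by exact_mod_cast h2
    omega

omit [DecidableEq α] in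
/-- Loops never change a rank: `ρ(X) = ρ(X₀)` for the non-loop part `X₀ = {e ∈ X : ρ({e}) ≠ 0}` of a finset `X ⊆ E`. -/
theorem eRk_nonloops (M : Matroid α) [M.Finite] (X : Finset α) (hX : X ⊆ gr M) :
    M.eRk ((X.filter (fun e => M.eRk {e} ≠ 0) : Finset α) : Set α) = M.eRk (X : Set α) := by
  apply le_antisymm
  · exact M.eRk_mono (coe_subset.2 (filter_subset _ _))
  · have hsub : (X : Set α) ⊆ ((X.filter (fun e => M.eRk {e} ≠ 0) : Finset α) : Set α) ∪ M.closure ∅ := by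
      intro e he
      by_cases h0 : M.eRk {e} = 0
      · right
        rw [Matroid.closure_empty]
        have heE : ({e} : Set α) ⊆ M.E := by
          rw [Set.singleton_subset_iff, ← coe_gr]; exact hX (mem_coe.1 he)
        exact ((M.eRk_eq_zero_iff heE).1 h0) (Set.mem_singleton e)
      · left
        rw [mem_coe, mem_filter]
        exact ⟨mem_coe.1 he, h0⟩
    calc M.eRk (X : Set α) ≤ M.eRk (((X.filter (fun e => M.eRk {e} ≠ 0) : Finset α) : Set α) ∪ M.closure ∅) :=
          M.eRk_mono hsub
      _ = M.eRk (((X.filter (fun e => M.eRk {e} ≠ 0) : Finset α) : Set α) ∪ ∅) :=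
          M.eRk_union_closure_right_eq _ _
      _ = M.eRk ((X.filter (fun e => M.eRk {e} ≠ 0) : Finset α) : Set α) := by rw [Set.union_empty]

/-- **The natural image of a residual source, loops allowed** (`residual_facts` for matroids whose circuits are loops
or have `≥ ρ(E)` points). -/
theorem residual_facts_loops (M : Matroid α) [M.Finite]
    (hpav : ∀ C, M.IsCircuit C → C.encard = 1 ∨ M.eRank ≤ C.encard) (K : Finset α → Finset α)
    (hK : ∀ X, K X ⊆ X ∧ M.Indep (K X : Set α) ∧ (K X).card = (M.eRk (X : Set α)).toNat)
    {hi δ : ℕ} {I D : Finset α} (hI : I ⊆ gr M) (hx : (M.eRk (I : Set α)).toNat ≤ hi)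
    (hf : hi + δ + 1 ≤ (M.eRk ((gr M \ I : Finset α) : Set α)).toNat)
    (hD : D ∈ powersetCard δ (K (gr M \ I))) :
    (M.eRk ((I ∪ D : Finset α) : Set α)).toNat = (M.eRk (I : Set α)).toNat + δ ∧
    D ⊆ K (I ∪ D) ∧
    hi + 1 ≤ (M.eRk ((gr M \ (I ∪ D) : Finset α) : Set α)).toNat := by
  rw [mem_powersetCard] at hD
  obtain ⟨hDK, hDcard⟩ := hD
  have hDE : D ⊆ gr M \ I := hDK.trans (hK _).1
  have hDI : Disjoint I D := disjoint_of_subset_right hDE sdiff_disjoint.symm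
  have hr : (M.eRk ((gr M \ I : Finset α) : Set α)).toNat ≤ M.eRank.toNat := toNat_eRk_le M _
  have hC : hi + 1 ≤ (M.eRk ((gr M \ (I ∪ D) : Finset α) : Set α)).toNat := by
    have h1 := toNat_eRk_le_toNat_eRk_sdiff_add_card M (gr M \ I) D
    have h2 : (gr M \ I) \ D = gr M \ (I ∪ D) := by
      ext a
      simp only [mem_sdiff, mem_union]
      tauto
    rw [h2] at h1
    omega
  rcases Nat.eq_zero_or_pos δ with hδ | hδ
  · subst hδ
    have hD0 : D = ∅ := card_eq_zero.1 hDcard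
    subst hD0
    exact ⟨by simp, by simp, hC⟩
  · -- the elements of `D` are not loops (`D` lies in an independent set)
    have hDloop : ∀ e ∈ D, M.eRk {e} ≠ 0 := by
      intro e he
      have hind : M.Indep ({e} : Set α) := (hK _).2.1.subset (by
        rw [Set.singleton_subset_iff]; exact mem_coe.2 (hDK he))
      rw [hind.eRk_eq_encard, Set.encard_singleton]
      exact one_ne_zero
    set I₀ := I.filter (fun e => M.eRk {e} ≠ 0) with hI₀
    have hI₀E : I₀ ⊆ gr M := (filter_subset _ _).trans hI
    have hI₀rk : M.eRk (I₀ : Set α) = M.eRk (I : Set α) := eRk_nonloops M I hI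
    have hI₀loop : ∀ e ∈ I₀, M.eRk {e} ≠ 0 := fun e he => (mem_filter.1 he).2
    have hI₀ind : M.Indep (I₀ : Set α) := by
      apply indep_of_loopless_eRk_add_two_le M hpav _ (by rw [← coe_gr]; exact coe_subset.2 hI₀E)
        (fun e he => hI₀loop e (mem_coe.1 he))
      rw [hI₀rk]
      omega
    have hI₀card : I₀.card = (M.eRk (I : Set α)).toNat := by
      rw [← hI₀rk, hI₀ind.eRk_eq_encard, Set.encard_coe_eq_coe_finsetCard, ENat.toNat_coe]
    -- the non-loop part of `I ∪ D` is `I₀ ∪ D`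
    have hfilt : (I ∪ D).filter (fun e => M.eRk {e} ≠ 0) = I₀ ∪ D := by
      rw [filter_union, filter_true_of_mem hDloop]
    have hUE : I ∪ D ⊆ gr M := union_subset hI (hDE.trans sdiff_subset)
    have hU₀E : I₀ ∪ D ⊆ gr M := union_subset hI₀E (hDE.trans sdiff_subset)
    have hU₀dis : Disjoint I₀ D := disjoint_of_subset_left (filter_subset _ _) hDI
    have hU₀card : (I₀ ∪ D).card = (M.eRk (I : Set α)).toNat + δ := by
      rw [card_union_of_disjoint hU₀dis, hI₀card, hDcard]
    have hU₀ind : M.Indep ((I₀ ∪ D : Finset α) : Set α) := by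
      apply indep_of_loopless_card_lt_rank M hpav _ hU₀E
      · intro e he
        rw [mem_union] at he
        rcases he with he | he
        · exact hI₀loop e he
        · exact hDloop e he
      · rw [hU₀card]
        omega
    have hA : (M.eRk ((I ∪ D : Finset α) : Set α)).toNat = (M.eRk (I : Set α)).toNat + δ := by
      rw [← eRk_nonloops M (I ∪ D) hUE, hfilt, hU₀ind.eRk_eq_encard, Set.encard_coe_eq_coe_finsetCard,
        ENat.toNat_coe, hU₀card]
    refine ⟨hA, ?_, hC⟩
    -- the selected basis of `I ∪ D` is loopless, hence inside `I₀ ∪ D`, hence equal to it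
    have hKsub : K (I ∪ D) ⊆ I₀ ∪ D := by
      intro e he
      have heU : e ∈ I ∪ D := (hK _).1 he
      have hne : M.eRk {e} ≠ 0 := by
        have hind : M.Indep ({e} : Set α) := (hK _).2.1.subset (by
          rw [Set.singleton_subset_iff]; exact mem_coe.2 he)
        rw [hind.eRk_eq_encard, Set.encard_singleton]
        exact one_ne_zero
      rw [← hfilt, mem_filter]
      exact ⟨heU, hne⟩
    have hKeq : K (I ∪ D) = I₀ ∪ D := by
      apply eq_of_subset_of_card_le hKsub
      rw [(hK _).2.2, hA, hU₀card]
    rw [hKeq]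
    exact subset_union_right

/-- **The injection `RS → THI`, loops allowed** (`card_residual_le_card_high` with `residual_facts_loops`). -/
theorem card_residual_le_card_high_loops (M : Matroid α) [M.Finite]
    (hpav : ∀ C, M.IsCircuit C → C.encard = 1 ∨ M.eRank ≤ C.encard) (K : Finset α → Finset α)
    (hK : ∀ X, K X ⊆ X ∧ M.Indep (K X : Set α) ∧ (K X).card = (M.eRk (X : Set α)).toNat)
    (lo hi δ : ℕ) :
    (((gr M).powerset.filter (fun I : Finset α => lo ≤ (M.eRk (I : Set α)).toNat ∧ (M.eRk (I : Set α)).toNat ≤ hi ∧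
        hi + δ + 1 ≤ (M.eRk ((gr M \ I : Finset α) : Set α)).toNat)).sigma
      (fun I : Finset α => powersetCard δ (K (gr M \ I)))).card ≤
    (((gr M).powerset.filter (fun J : Finset α => lo + δ ≤ (M.eRk ((gr M \ J : Finset α) : Set α)).toNat ∧
        (M.eRk ((gr M \ J : Finset α) : Set α)).toNat ≤ hi + δ ∧ hi + 1 ≤ (M.eRk (J : Set α)).toNat)).sigma
      (fun J : Finset α => powersetCard δ (K (gr M \ J)))).card := by
  apply card_le_card_of_injOn (fun p => (⟨gr M \ (p.1 ∪ p.2), p.2⟩ : Σ _ : Finset α, Finset α))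
  · intro p hp
    rw [mem_coe, mem_sigma, mem_filter, mem_powerset] at hp
    obtain ⟨⟨hI, hlo, hhi, hf⟩, hD⟩ := hp
    obtain ⟨hA, hB, hC⟩ := residual_facts_loops M hpav K hK hI hhi hf hD
    have hUE : p.1 ∪ p.2 ⊆ gr M := by
      rw [mem_powersetCard] at hD
      exact union_subset hI ((hD.1.trans (hK _).1).trans sdiff_subset)
    rw [mem_coe, mem_sigma, mem_filter, mem_powerset]
    refine ⟨⟨sdiff_subset, ?_⟩, ?_⟩
    · rw [Finset.sdiff_sdiff_eq_self hUE, hA]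
      exact ⟨by omega, by omega, hC⟩
    · rw [Finset.sdiff_sdiff_eq_self hUE, mem_powersetCard]
      rw [mem_powersetCard] at hD
      exact ⟨hB, hD.2⟩
  · intro p hp q hq hpq
    rw [mem_coe, mem_sigma, mem_filter, mem_powerset] at hp hq
    obtain ⟨⟨hIp, -, -, -⟩, hDp⟩ := hp
    obtain ⟨⟨hIq, -, -, -⟩, hDq⟩ := hq
    rw [mem_powersetCard] at hDp hDq
    have hDpE : p.2 ⊆ gr M \ p.1 := hDp.1.trans (hK _).1
    have hDqE : q.2 ⊆ gr M \ q.1 := hDq.1.trans (hK _).1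
    have hUp : p.1 ∪ p.2 ⊆ gr M := union_subset hIp (hDpE.trans sdiff_subset)
    have hUq : q.1 ∪ q.2 ⊆ gr M := union_subset hIq (hDqE.trans sdiff_subset)
    simp only [Sigma.mk.inj_iff, heq_eq_eq] at hpq
    obtain ⟨h1, h2⟩ := hpq
    have h3 : p.1 ∪ p.2 = q.1 ∪ q.2 := by
      rw [← Finset.sdiff_sdiff_eq_self hUp, ← Finset.sdiff_sdiff_eq_self hUq, h1]
    have h4 : p.1 = q.1 := by
      have hp' : p.1 = (p.1 ∪ p.2) \ p.2 :=
        (union_sdiff_cancel_right (disjoint_of_subset_right hDpE sdiff_disjoint.symm)).symm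
      have hq' : q.1 = (q.1 ∪ q.2) \ q.2 :=
        (union_sdiff_cancel_right (disjoint_of_subset_right hDqE sdiff_disjoint.symm)).symm
      rw [hp', hq', h3, h2]
    exact Sigma.ext h4 (heq_of_eq h2)

/-- **(PLD) ON EVERY FINITE MATROID WHOSE CIRCUITS ARE LOOPS OR HAVE `≥ ρ(E)` POINTS**, in the bridge's binder. -/
theorem pld_of_paving_loops (M : Matroid α) [M.Finite]
    (hpav : ∀ C, M.IsCircuit C → C.encard = 1 ∨ M.eRank ≤ C.encard) :
    ∀ lo hi δ Θ : ℕ, Θ ≤ lo + hi + δ → (lo = 0 ∨ lo + hi + δ ≤ Θ) →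
      (∑ I ∈ (gr M).powerset, (if lo ≤ (M.eRk (I : Set α)).toNat ∧ (M.eRk (I : Set α)).toNat ≤ hi ∧
          Θ ≤ (M.eRk ((gr M \ I : Finset α) : Set α)).toNat + (M.eRk (I : Set α)).toNat then
          ((M.eRk ((gr M \ I : Finset α) : Set α)).toNat).choose δ else 0)) ≤
        ∑ I ∈ (gr M).powerset, (if lo + δ ≤ (M.eRk ((gr M \ I : Finset α) : Set α)).toNat ∧
          (M.eRk ((gr M \ I : Finset α) : Set α)).toNat ≤ hi + δ then
          ((M.eRk ((gr M \ I : Finset α) : Set α)).toNat).choose δ else 0) := by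
  choose K hK using exists_indep_subset_card_eq M
  exact pld_of_card_residual_le_all M K hK (fun lo hi δ => card_residual_le_card_high_loops M hpav K hK lo hi δ)

omit [DecidableEq α] in
/-- Every matroid of rank `≤ 2` has only circuits that are loops or have `≥ ρ(E)` points. -/
theorem circuits_of_eRank_le_two (M : Matroid α) (h : M.eRank ≤ 2) :
    ∀ C, M.IsCircuit C → C.encard = 1 ∨ M.eRank ≤ C.encard := by
  intro C hC
  have hne : 1 ≤ C.encard := Set.one_le_encard_iff_nonempty.2 hC.nonempty
  by_cases h1 : C.encard = 1
  · exact Or.inl h1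
  · right
    have h2 : (2 : ℕ∞) ≤ C.encard := by
      have : (1 : ℕ∞) < C.encard := lt_of_le_of_ne hne (Ne.symm h1)
      exact Order.add_one_le_of_lt this
    exact h.trans h2

/-- **(PLD) ON EVERY FINITE MATROID OF RANK `≤ 2`**, in the bridge's binder. -/
theorem pld_of_eRank_le_two (M : Matroid α) [M.Finite] (h : M.eRank ≤ 2) :
    ∀ lo hi δ Θ : ℕ, Θ ≤ lo + hi + δ → (lo = 0 ∨ lo + hi + δ ≤ Θ) →
      (∑ I ∈ (gr M).powerset, (if lo ≤ (M.eRk (I : Set α)).toNat ∧ (M.eRk (I : Set α)).toNat ≤ hi ∧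
          Θ ≤ (M.eRk ((gr M \ I : Finset α) : Set α)).toNat + (M.eRk (I : Set α)).toNat then
          ((M.eRk ((gr M \ I : Finset α) : Set α)).toNat).choose δ else 0)) ≤
        ∑ I ∈ (gr M).powerset, (if lo + δ ≤ (M.eRk ((gr M \ I : Finset α) : Set α)).toNat ∧
          (M.eRk ((gr M \ I : Finset α) : Set α)).toNat ≤ hi + δ then
          ((M.eRk ((gr M \ I : Finset α) : Set α)).toNat).choose δ else 0) :=
  pld_of_paving_loops M (circuits_of_eRank_le_two M h)

/-- **C-025 AT EVERY `(p, q)` ON EVERY TRUNCATION OF «A MATROID OF RANK `≤ 2` PLUS FREE POINTS».** -/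
theorem rls_truncate_disjointSum_freeOn_of_eRank_le_two (M : Matroid α) [M.Finite] (h2 : M.eRank ≤ 2)
    (E₃ : Finset α) (h : Disjoint M.E (E₃ : Set α)) (r p q : ℕ) :
    haveI := PLDBridge.disjointSum_freeOn_finite M E₃ h
    ThmN.RLS (Matroid.truncate (M.disjointSum (Matroid.freeOn (E₃ : Set α)) h) r) p q :=
  PLDBridge.rls_disjointSum_freeOn_of_pld M E₃ h r p q (pld_of_eRank_le_two M h2)

/-- **C-025 AT EVERY `(p, q)` ON EVERY TRUNCATION OF «PAVING-WITH-LOOPS PLUS FREE POINTS».** -/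
theorem rls_truncate_disjointSum_freeOn_of_paving_loops (M : Matroid α) [M.Finite]
    (hpav : ∀ C, M.IsCircuit C → C.encard = 1 ∨ M.eRank ≤ C.encard)
    (E₃ : Finset α) (h : Disjoint M.E (E₃ : Set α)) (r p q : ℕ) :
    haveI := PLDBridge.disjointSum_freeOn_finite M E₃ h
    ThmN.RLS (Matroid.truncate (M.disjointSum (Matroid.freeOn (E₃ : Set α)) h) r) p q :=
  PLDBridge.rls_disjointSum_freeOn_of_pld M E₃ h r p q (pld_of_paving_loops M hpav)

end PavingPLD

end PercRepro
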